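import Summits.ValiantsHypothesis.ValiantsHypothesis.Theorems.KPlusLogSqLawStaticTridiagonalThreeByThree

/-!
# THREE-BY-THREE LAW is SHARP: a static definite tridiagonal `3 × 3` design with exactly the positive determinant zeros `1` and `2` (Part 8)

HONEST FRAMING.  Helper datum (`--supports stmt-ValiantsHypothesis-19561 --as helper`; seat val-sym-lift-p2 g9, cell `pub-symmetroid`,
2026-08-27): the all-designs upper row `card_posRoots_three_le_two_all` (`Z ≤ 2` for every static definite tridiagonal `3 × 3` design,
Part 5) is ATTAINED in the kernel: the design `diag (X², X², X²)`, links `(2/√5)·X` and `(1/√5)·X³` has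
`det = −(1/5)·X⁴ (X² − 1)(X² − 4)`, whose positive zeros are `1` and `2`.  So `B 3 = 2` exactly on this sector.  Calibration only; nothing
here bears on `WeakLifting` (stmt-19561) / `TropicalB` (stmt-19771) in their windows, Conjecture B, the Door-A registers, `MatrixDescartes`
(stmt-ValiantsHypothesis-18050) or VP ≠ VNP.

WHAT IS PROVED.  `exists_staticTridiagonal_definite_three_two` — a `3 × 3` design in R2102's currency (`c`, `e` symmetric, `c = 0` off the
band, `0 < c i i`) with `2 ≤ card` of the positive roots of its determinant; with Part 5 (`card_posRoots_three_le_two_all`):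
**`exists_staticTridiagonal_definite_three_card_eq_two`** — the bound `2` is attained, i.e. `B 3 = 2` exactly.
[this file; Part 5 of this seat]
-/

set_option linter.dupNamespace false
set_option autoImplicit false

namespace Summit.ValiantsHypothesis.ValiantsHypothesis.Theorems.KPlusLogSqLaw.DefiniteInterpolation

open Polynomial

/-- **A static definite tridiagonal `3 × 3` design with (at least) TWO positive determinant zeros**: `c = !![1, 2/√5, 0; 2/√5, 1, 1/√5;
0, 1/√5, 1]`, `e = !![2, 1, 0; 1, 2, 3; 0, 3, 2]`; its determinant `X⁶ − (4/5)X⁴ − (1/5)X⁸` vanishes at `1` and `2`. [this file] -/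
theorem exists_staticTridiagonal_definite_three_two :
    ∃ (c : Fin 3 → Fin 3 → ℝ) (e : Fin 3 → Fin 3 → ℕ), (∀ i j, c i j = c j i) ∧ (∀ i j, e i j = e j i) ∧
      (∀ i j : Fin 3, (i : ℕ) + 1 < j ∨ (j : ℕ) + 1 < i → c i j = 0) ∧ (∀ i, 0 < c i i) ∧
      2 ≤ ((Matrix.det (Matrix.of fun i j => C (c i j) * (X : ℝ[X]) ^ e i j)).roots.toFinset.filter
        (fun t : ℝ => 0 < t)).card := by
  set s : ℝ := Real.sqrt 5 with hs
  have hs0 : 0 < s := Real.sqrt_pos.mpr (by norm_num)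
  have hs2 : s * s = 5 := Real.mul_self_sqrt (by norm_num)
  refine ⟨!![1, 2 / s, 0; 2 / s, 1, 1 / s; 0, 1 / s, 1], !![2, 1, 0; 1, 2, 3; 0, 3, 2], ?_, ?_, ?_, ?_, ?_⟩
  · intro i j; fin_cases i <;> fin_cases j <;> rfl
  · intro i j; fin_cases i <;> fin_cases j <;> rfl
  · intro i j hij
    fin_cases i <;> fin_cases j <;> simp_all
  · intro i; fin_cases i <;> simp
  · set P : ℝ[X] := Matrix.det (Matrix.of fun i j =>
      C (!![1, 2 / s, 0; 2 / s, 1, 1 / s; 0, 1 / s, 1] i j) * (X : ℝ[X]) ^ (!![2, 1, 0; 1, 2, 3; 0, 3, 2] : Fin 3 → Fin 3 → ℕ) i j) with hP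
    -- the determinant polynomial, explicitly
    have hdet : P = X ^ 6 - C (4 / 5) * X ^ 4 - C (1 / 5) * X ^ 8 := by
      rw [hP, Matrix.det_fin_three]
      simp only [Matrix.of_apply, Matrix.cons_val', Matrix.cons_val_zero, Matrix.cons_val_one, Matrix.head_cons,
        Matrix.head_fin_const, Matrix.empty_val', Matrix.cons_val_fin_one, Matrix.cons_val_two, Matrix.tail_cons,
        Matrix.head_cons]
      have h45 : (2 / s) * (2 / s) = 4 / 5 := by
        rw [div_mul_div_comm, hs2]; norm_num
      have h15 : (1 / s) * (1 / s) = 1 / 5 := by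
        rw [div_mul_div_comm, hs2]; norm_num
      have e1 : C (2 / s) * C (2 / s) = (C (4 / 5) : ℝ[X]) := by rw [← C_mul, h45]
      have e2 : C (1 / s) * C (1 / s) = (C (1 / 5) : ℝ[X]) := by rw [← C_mul, h15]
      simp only [map_one, map_zero, one_mul, zero_mul, mul_zero, pow_zero, mul_one, sub_zero, add_zero]
      linear_combination (X ^ 4 : ℝ[X]) * e1 * (-1) + (X : ℝ[X]) ^ 8 * e2 * (-1)
    have hP0 : P ≠ 0 := by
      rw [hdet]
      intro h
      have := congrArg (fun p : ℝ[X] => p.eval 3) h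
      simp at this
      norm_num at this
    have hroot : ∀ t : ℝ, t = 1 ∨ t = 2 → P.IsRoot t := by
      intro t ht
      rw [hdet, Polynomial.IsRoot.def]
      rcases ht with rfl | rfl <;> simp <;> norm_num
    have hsub : ({1, 2} : Finset ℝ) ⊆ P.roots.toFinset.filter (fun t : ℝ => 0 < t) := by
      intro t ht
      rw [Finset.mem_insert, Finset.mem_singleton] at ht
      rw [Finset.mem_filter, Multiset.mem_toFinset, Polynomial.mem_roots hP0]
      refine ⟨hroot t ht, ?_⟩
      rcases ht with rfl | rfl <;> norm_num
    calc 2 = ({1, 2} : Finset ℝ).card := by rw [Finset.card_pair (by norm_num)]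
      _ ≤ _ := Finset.card_le_card hsub

/-- **`B 3 = 2` on the static definite tridiagonal sector**: some `3 × 3` design attains the all-designs bound of Part 5 — its determinant
has EXACTLY two distinct positive zeros. [this file + Part 5] -/
theorem exists_staticTridiagonal_definite_three_card_eq_two :
    ∃ (c : Fin 3 → Fin 3 → ℝ) (e : Fin 3 → Fin 3 → ℕ), (∀ i j, c i j = c j i) ∧ (∀ i j, e i j = e j i) ∧
      (∀ i j : Fin 3, (i : ℕ) + 1 < j ∨ (j : ℕ) + 1 < i → c i j = 0) ∧ (∀ i, 0 < c i i) ∧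
      ((Matrix.det (Matrix.of fun i j => C (c i j) * (X : ℝ[X]) ^ e i j)).roots.toFinset.filter
        (fun t : ℝ => 0 < t)).card = 2 := by
  obtain ⟨c, e, hc, he, hband, hpos, h2⟩ := exists_staticTridiagonal_definite_three_two
  exact ⟨c, e, hc, he, hband, hpos, le_antisymm (card_posRoots_three_le_two_all c e hc hband hpos) h2⟩

end Summit.ValiantsHypothesis.ValiantsHypothesis.Theorems.KPlusLogSqLaw.DefiniteInterpolation
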